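import Summits.HodgeConjecture.HodgeConjecture.Theorems.Ring2WeilCoverageNormTable
import Summits.HodgeConjecture.HodgeConjecture.Theorems.Ring2WeilNormObstructionDescentCensus
import HarnessLib

/-!
# Ring 2 · Weil-type family-coverage census (ring2-b04, gen 40) — NORM-CLASS TABLE, part B (`d = 7, 11, 19, 43, 67, 163`)

research route conditional on HC_CM; not a corollary; Q11.4-sentence-2 already refuted in dim ≥ 3.
`HC_CM` (`Theses.RankFourFaces.CMAbelianHodge`, by name) does not occur in this file; no case of the Hodge
conjecture is claimed. Cell `pub-hodge-ring2`, seat `ring2-b04` (gen 40); companion of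
`Ring2WeilCoverageNormCriteria` (the general criteria). This file is the TREE-STATUS column of the census file
`WEIL-FAMILY-COVERAGE.md` §b04: for the imaginary quadratic fields `K = ℚ(√-d)` of the consumer's tables
(pub-hsemireg `target-g6/TARGET-TABLE.md` rows R0–R4, `general-structure/G3-COVERAGE.md` §4) and the representatives
`a` of the discriminant classes met there, it DECIDES in the kernel whether `a ∈ Nm(Kˣ)` — equivalently (Landherr /
van Geemen (5.4.1), `Ring2.WeilCoverage.mk_neg_eq_splitDiscriminantClass_iff_of_odd` / `…_of_even`) whether the
component `(n, K, δ = [(-1)ⁿ a])` is the SPLIT one, i.e. contains a hyperbolic member (`X × X̂`-type, product of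
Weil-type surfaces with hyperbolic `H`, the uniformly weighted `E_Kⁿ × E_Kⁿ`). Each entry is ONE LINE over the
criteria: an explicit representation `a = x² + d y²` (norm), or a descent at one inert / ramified prime (non-norm),
or a quotient of two earlier entries. The values agree with the seat's independent computation
(`census/normclass_b04.py`, Hilbert symbols + witness search) and with pub-hsemireg gs-eng-2's tables (×2).

## Contents (part B; part A = `Ring2WeilCoverageNormTable`: §0 wrappers, `d = 1, 2, 3` and their cell keys)

* the tables for `d = 7, 11` (squarefree `a ≤ 15`) and `d = 19, 43, 67, 163` (`a = 2, 3` non-norms and the least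
  norm `> 1`), namespaces `SqrtNeg7`, …, `SqrtNeg163`;
* the consumer's sixfold CELL KEYS of row R4: `sixfold_sqrtNeg7_neg3_ne_split`, …, `sixfold_sqrtNeg163_neg2_ne_split`,
  and the split identifications `[(-2 : ℚ)] = splitDiscriminantClass 3 7`, `[(-3 : ℚ)] = splitDiscriminantClass 3 11`.

Sorry-free; axioms standard; no `def`, no named fact; `decide` only on residues modulo primes `≤ 163`.

## References

* [vanGeemen1994HodgeAV] B. van Geemen, LNM 1594 (1994), 4.14, 5.4 and (5.4.1).
* [Serre1973] J.-P. Serre, A Course in Arithmetic (1973), Ch. III §1, Ch. IV §3.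
-/

noncomputable section

set_option linter.dupNamespace false

open Literature.AlgebraicGeometry.Motives
open Literature.AlgebraicGeometry.VanGeemen1994
open Summit.HodgeConjecture.HodgeConjecture.Ring2.Hypotheses

namespace Summit.HodgeConjecture.HodgeConjecture.Ring2.WeilCoverage

/-! ### §4 `K = ℚ(√-7)` (disc -7; ramified {7}; inert primes ≡ 3, 5, 6 (mod 7); `2 = Nm((1+√-7)/2)` splits) -/

namespace SqrtNeg7

/-- `1 ∈ Nm(ℚ(√-7)ˣ)`: `1 = 1² + 7·0²` — the split class. research route conditional on HC_CM; not a corollary; Q11.4-sentence-2 already refuted in dim ≥ 3. [cite: vanGeemen1994HodgeAV, (5.4.1)] -/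
theorem mem_1 : Units.mk0 (1 : ℚ) (by norm_num) ∈ normUnitsSubgroup ℚ (weilField 7) :=
  mem_normUnitsSubgroup_of_sq_add_mul_sq _ 1 0 (by norm_num)

/-- `2 ∈ Nm(ℚ(√-7)ˣ)`: `2 = 1/2² + 7·1/2²`. research route conditional on HC_CM; not a corollary; Q11.4-sentence-2 already refuted in dim ≥ 3. [cite: vanGeemen1994HodgeAV, (5.4.1)] -/
theorem mem_2 : Units.mk0 (2 : ℚ) (by norm_num) ∈ normUnitsSubgroup ℚ (weilField 7) :=
  mem_normUnitsSubgroup_of_sq_add_mul_sq _ (1 / 2 : ℚ) (1 / 2 : ℚ) (by norm_num)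

-- `3 ∉ Nm(ℚ(√-7)ˣ)` (`T(3) = {3, 7}`): in the tree as `Summit.HodgeConjecture.Ring2WeilNormDescent.three_not_mem_norm_seven` (ring2-b02, `Ring2WeilNormObstructionDescentCensus`) — reused, not restated.

-- `5 ∉ Nm(ℚ(√-7)ˣ)` (`T(5) = {5, 7}`): in the tree as `Summit.HodgeConjecture.Ring2WeilNormDescent.five_not_mem_norm_seven` (ring2-b02, `Ring2WeilNormObstructionDescentCensus`) — reused, not restated.

/-- `6 ∉ Nm(ℚ(√-7)ˣ)`: descent at the inert prime `3` (`-7` is a non-square mod `3`, `3 ∥ 6`); `T(6) = {3, 7}`. research route conditional on HC_CM; not a corollary; Q11.4-sentence-2 already refuted in dim ≥ 3. [cite: Serre1973, Ch. III §1] -/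
theorem not_mem_6 : Units.mk0 (6 : ℚ) (by norm_num) ∉ normUnitsSubgroup ℚ (weilField 7) := by
  simpa using natCast_not_mem_normUnitsSubgroup_of_inert (d := 7) (a := 6) (p := 3)
    (by norm_num) (by decide) (by norm_num) (by norm_num) (by norm_num)

/-- `7 ∈ Nm(ℚ(√-7)ˣ)`: `7 = 0² + 7·1²`. research route conditional on HC_CM; not a corollary; Q11.4-sentence-2 already refuted in dim ≥ 3. [cite: vanGeemen1994HodgeAV, (5.4.1)] -/
theorem mem_7 : Units.mk0 (7 : ℚ) (by norm_num) ∈ normUnitsSubgroup ℚ (weilField 7) :=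
  mem_normUnitsSubgroup_of_sq_add_mul_sq _ 0 1 (by norm_num)

/-- `10 ∉ Nm(ℚ(√-7)ˣ)`: descent at the inert prime `5` (`-7` is a non-square mod `5`, `5 ∥ 10`); `T(10) = {5, 7}`. research route conditional on HC_CM; not a corollary; Q11.4-sentence-2 already refuted in dim ≥ 3. [cite: Serre1973, Ch. III §1] -/
theorem not_mem_10 : Units.mk0 (10 : ℚ) (by norm_num) ∉ normUnitsSubgroup ℚ (weilField 7) := by
  simpa using natCast_not_mem_normUnitsSubgroup_of_inert (d := 7) (a := 10) (p := 5)
    (by norm_num) (by decide) (by norm_num) (by norm_num) (by norm_num)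

/-- `11 ∈ Nm(ℚ(√-7)ˣ)`: `11 = 2² + 7·1²`. research route conditional on HC_CM; not a corollary; Q11.4-sentence-2 already refuted in dim ≥ 3. [cite: vanGeemen1994HodgeAV, (5.4.1)] -/
theorem mem_11 : Units.mk0 (11 : ℚ) (by norm_num) ∈ normUnitsSubgroup ℚ (weilField 7) :=
  mem_normUnitsSubgroup_of_sq_add_mul_sq _ 2 1 (by norm_num)

-- `13 ∉ Nm(ℚ(√-7)ˣ)` (`T(13) = {7, 13}`): in the tree as `Summit.HodgeConjecture.Ring2WeilNormDescent.thirteen_not_mem_norm_seven` (ring2-b02, `Ring2WeilNormObstructionDescentCensus`) — reused, not restated.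

/-- `14 ∈ Nm(ℚ(√-7)ˣ)`: `14 = 7/2² + 7·1/2²`. research route conditional on HC_CM; not a corollary; Q11.4-sentence-2 already refuted in dim ≥ 3. [cite: vanGeemen1994HodgeAV, (5.4.1)] -/
theorem mem_14 : Units.mk0 (14 : ℚ) (by norm_num) ∈ normUnitsSubgroup ℚ (weilField 7) :=
  mem_normUnitsSubgroup_of_sq_add_mul_sq _ (7 / 2 : ℚ) (1 / 2 : ℚ) (by norm_num)

/-- `15 ∉ Nm(ℚ(√-7)ˣ)`: descent at the inert prime `3` (`-7` is a non-square mod `3`, `3 ∥ 15`); `T(15) = {3, 5}`. research route conditional on HC_CM; not a corollary; Q11.4-sentence-2 already refuted in dim ≥ 3. [cite: Serre1973, Ch. III §1] -/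
theorem not_mem_15 : Units.mk0 (15 : ℚ) (by norm_num) ∉ normUnitsSubgroup ℚ (weilField 7) := by
  simpa using natCast_not_mem_normUnitsSubgroup_of_inert (d := 7) (a := 15) (p := 3)
    (by norm_num) (by decide) (by norm_num) (by norm_num) (by norm_num)

end SqrtNeg7

/-! ### §5 `K = ℚ(√-11)` (disc -11; ramified {11}; inert primes = non-residues mod 11 (2, 6, 7, 8, 10 mod 11)) -/

namespace SqrtNeg11

/-- `1 ∈ Nm(ℚ(√-11)ˣ)`: `1 = 1² + 11·0²` — the split class. research route conditional on HC_CM; not a corollary; Q11.4-sentence-2 already refuted in dim ≥ 3. [cite: vanGeemen1994HodgeAV, (5.4.1)] -/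
theorem mem_1 : Units.mk0 (1 : ℚ) (by norm_num) ∈ normUnitsSubgroup ℚ (weilField 11) :=
  mem_normUnitsSubgroup_of_sq_add_mul_sq _ 1 0 (by norm_num)

-- `2 ∉ Nm(ℚ(√-11)ˣ)` (`T(2) = {2, 11}`): in the tree as `Summit.HodgeConjecture.Ring2WeilNormDescent.two_not_mem_norm_eleven` (ring2-b02, `Ring2WeilNormObstructionDescentCensus`) — reused, not restated.

/-- `3 ∈ Nm(ℚ(√-11)ˣ)`: `3 = 1/2² + 11·1/2²`. research route conditional on HC_CM; not a corollary; Q11.4-sentence-2 already refuted in dim ≥ 3. [cite: vanGeemen1994HodgeAV, (5.4.1)] -/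
theorem mem_3 : Units.mk0 (3 : ℚ) (by norm_num) ∈ normUnitsSubgroup ℚ (weilField 11) :=
  mem_normUnitsSubgroup_of_sq_add_mul_sq _ (1 / 2 : ℚ) (1 / 2 : ℚ) (by norm_num)

/-- `5 ∈ Nm(ℚ(√-11)ˣ)`: `5 = 3/2² + 11·1/2²`. research route conditional on HC_CM; not a corollary; Q11.4-sentence-2 already refuted in dim ≥ 3. [cite: vanGeemen1994HodgeAV, (5.4.1)] -/
theorem mem_5 : Units.mk0 (5 : ℚ) (by norm_num) ∈ normUnitsSubgroup ℚ (weilField 11) :=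
  mem_normUnitsSubgroup_of_sq_add_mul_sq _ (3 / 2 : ℚ) (1 / 2 : ℚ) (by norm_num)

/-- `6 ∉ Nm(ℚ(√-11)ˣ)`: descent at the ramified prime `11` (`11 ∥ 11`, `6` is a non-square mod `11`); `T(6) = {2, 11}`. research route conditional on HC_CM; not a corollary; Q11.4-sentence-2 already refuted in dim ≥ 3. [cite: Serre1973, Ch. III §1] -/
theorem not_mem_6 : Units.mk0 (6 : ℚ) (by norm_num) ∉ normUnitsSubgroup ℚ (weilField 11) := by
  simpa using natCast_not_mem_normUnitsSubgroup_of_ramified (d := 11) (a := 6) (p := 11)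
    (by norm_num) (by norm_num) (by norm_num) (by decide) (by norm_num)

-- `7 ∉ Nm(ℚ(√-11)ˣ)` (`T(7) = {7, 11}`): in the tree as `Summit.HodgeConjecture.Ring2WeilNormDescent.seven_not_mem_norm_eleven` (ring2-b02, `Ring2WeilNormObstructionDescentCensus`) — reused, not restated.

/-- `10 ∉ Nm(ℚ(√-11)ˣ)`: descent at the ramified prime `11` (`11 ∥ 11`, `10` is a non-square mod `11`); `T(10) = {2, 11}`. research route conditional on HC_CM; not a corollary; Q11.4-sentence-2 already refuted in dim ≥ 3. [cite: Serre1973, Ch. III §1] -/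
theorem not_mem_10 : Units.mk0 (10 : ℚ) (by norm_num) ∉ normUnitsSubgroup ℚ (weilField 11) := by
  simpa using natCast_not_mem_normUnitsSubgroup_of_ramified (d := 11) (a := 10) (p := 11)
    (by norm_num) (by norm_num) (by norm_num) (by decide) (by norm_num)

/-- `11 ∈ Nm(ℚ(√-11)ˣ)`: `11 = 0² + 11·1²`. research route conditional on HC_CM; not a corollary; Q11.4-sentence-2 already refuted in dim ≥ 3. [cite: vanGeemen1994HodgeAV, (5.4.1)] -/
theorem mem_11 : Units.mk0 (11 : ℚ) (by norm_num) ∈ normUnitsSubgroup ℚ (weilField 11) :=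
  mem_normUnitsSubgroup_of_sq_add_mul_sq _ 0 1 (by norm_num)

/-- `13 ∉ Nm(ℚ(√-11)ˣ)`: descent at the ramified prime `11` (`11 ∥ 11`, `13` is a non-square mod `11`); `T(13) = {11, 13}`. research route conditional on HC_CM; not a corollary; Q11.4-sentence-2 already refuted in dim ≥ 3. [cite: Serre1973, Ch. III §1] -/
theorem not_mem_13 : Units.mk0 (13 : ℚ) (by norm_num) ∉ normUnitsSubgroup ℚ (weilField 11) := by
  simpa using natCast_not_mem_normUnitsSubgroup_of_ramified (d := 11) (a := 13) (p := 11)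
    (by norm_num) (by norm_num) (by norm_num) (by decide) (by norm_num)

/-- `14 ∉ Nm(ℚ(√-11)ˣ)`: descent at the inert prime `7` (`-11` is a non-square mod `7`, `7 ∥ 14`); `T(14) = {2, 7}`. research route conditional on HC_CM; not a corollary; Q11.4-sentence-2 already refuted in dim ≥ 3. [cite: Serre1973, Ch. III §1] -/
theorem not_mem_14 : Units.mk0 (14 : ℚ) (by norm_num) ∉ normUnitsSubgroup ℚ (weilField 11) := by
  simpa using natCast_not_mem_normUnitsSubgroup_of_inert (d := 11) (a := 14) (p := 7)
    (by norm_num) (by decide) (by norm_num) (by norm_num) (by norm_num)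

/-- `15 ∈ Nm(ℚ(√-11)ˣ)`: `15 = 2² + 11·1²`. research route conditional on HC_CM; not a corollary; Q11.4-sentence-2 already refuted in dim ≥ 3. [cite: vanGeemen1994HodgeAV, (5.4.1)] -/
theorem mem_15 : Units.mk0 (15 : ℚ) (by norm_num) ∈ normUnitsSubgroup ℚ (weilField 11) :=
  mem_normUnitsSubgroup_of_sq_add_mul_sq _ 2 1 (by norm_num)

end SqrtNeg11

/-! ### §6 The class-number-one fields `ℚ(√-19)`, `ℚ(√-43)`, `ℚ(√-67)`, `ℚ(√-163)`: `2` and `3` are inert, the least norm `> 1` -/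

namespace SqrtNeg19

/-- `2 ∉ Nm(ℚ(√-19)ˣ)`: descent at the ramified prime `19` (`19 ∥ 19`, `2` is a non-square mod `19`); `T(2) = {2, 19}`. research route conditional on HC_CM; not a corollary; Q11.4-sentence-2 already refuted in dim ≥ 3. [cite: Serre1973, Ch. III §1] -/
theorem not_mem_2 : Units.mk0 (2 : ℚ) (by norm_num) ∉ normUnitsSubgroup ℚ (weilField 19) := by
  simpa using natCast_not_mem_normUnitsSubgroup_of_ramified (d := 19) (a := 2) (p := 19)
    (by norm_num) (by norm_num) (by norm_num) (by decide) (by norm_num)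

/-- `3 ∉ Nm(ℚ(√-19)ˣ)`: descent at the inert prime `3` (`-19` is a non-square mod `3`, `3 ∥ 3`); `T(3) = {3, 19}`. research route conditional on HC_CM; not a corollary; Q11.4-sentence-2 already refuted in dim ≥ 3. [cite: Serre1973, Ch. III §1] -/
theorem not_mem_3 : Units.mk0 (3 : ℚ) (by norm_num) ∉ normUnitsSubgroup ℚ (weilField 19) := by
  simpa using natCast_not_mem_normUnitsSubgroup_of_inert (d := 19) (a := 3) (p := 3)
    (by norm_num) (by decide) (by norm_num) (by norm_num) (by norm_num)

/-- `5 ∈ Nm(ℚ(√-19)ˣ)`: `5 = 1/2² + 19·1/2²`. research route conditional on HC_CM; not a corollary; Q11.4-sentence-2 already refuted in dim ≥ 3. [cite: vanGeemen1994HodgeAV, (5.4.1)] -/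
theorem mem_5 : Units.mk0 (5 : ℚ) (by norm_num) ∈ normUnitsSubgroup ℚ (weilField 19) :=
  mem_normUnitsSubgroup_of_sq_add_mul_sq _ (1 / 2 : ℚ) (1 / 2 : ℚ) (by norm_num)

end SqrtNeg19

namespace SqrtNeg43

/-- `2 ∉ Nm(ℚ(√-43)ˣ)`: descent at the ramified prime `43` (`43 ∥ 43`, `2` is a non-square mod `43`); `T(2) = {2, 43}`. research route conditional on HC_CM; not a corollary; Q11.4-sentence-2 already refuted in dim ≥ 3. [cite: Serre1973, Ch. III §1] -/
theorem not_mem_2 : Units.mk0 (2 : ℚ) (by norm_num) ∉ normUnitsSubgroup ℚ (weilField 43) := by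
  simpa using natCast_not_mem_normUnitsSubgroup_of_ramified (d := 43) (a := 2) (p := 43)
    (by norm_num) (by norm_num) (by norm_num) (by decide) (by norm_num)

/-- `3 ∉ Nm(ℚ(√-43)ˣ)`: descent at the inert prime `3` (`-43` is a non-square mod `3`, `3 ∥ 3`); `T(3) = {3, 43}`. research route conditional on HC_CM; not a corollary; Q11.4-sentence-2 already refuted in dim ≥ 3. [cite: Serre1973, Ch. III §1] -/
theorem not_mem_3 : Units.mk0 (3 : ℚ) (by norm_num) ∉ normUnitsSubgroup ℚ (weilField 43) := by
  simpa using natCast_not_mem_normUnitsSubgroup_of_inert (d := 43) (a := 3) (p := 3)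
    (by norm_num) (by decide) (by norm_num) (by norm_num) (by norm_num)

/-- `11 ∈ Nm(ℚ(√-43)ˣ)`: `11 = 1/2² + 43·1/2²`. research route conditional on HC_CM; not a corollary; Q11.4-sentence-2 already refuted in dim ≥ 3. [cite: vanGeemen1994HodgeAV, (5.4.1)] -/
theorem mem_11 : Units.mk0 (11 : ℚ) (by norm_num) ∈ normUnitsSubgroup ℚ (weilField 43) :=
  mem_normUnitsSubgroup_of_sq_add_mul_sq _ (1 / 2 : ℚ) (1 / 2 : ℚ) (by norm_num)

end SqrtNeg43

namespace SqrtNeg67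

/-- `2 ∉ Nm(ℚ(√-67)ˣ)`: descent at the ramified prime `67` (`67 ∥ 67`, `2` is a non-square mod `67`); `T(2) = {2, 67}`. research route conditional on HC_CM; not a corollary; Q11.4-sentence-2 already refuted in dim ≥ 3. [cite: Serre1973, Ch. III §1] -/
theorem not_mem_2 : Units.mk0 (2 : ℚ) (by norm_num) ∉ normUnitsSubgroup ℚ (weilField 67) := by
  simpa using natCast_not_mem_normUnitsSubgroup_of_ramified (d := 67) (a := 2) (p := 67)
    (by norm_num) (by norm_num) (by norm_num) (by decide) (by norm_num)

/-- `3 ∉ Nm(ℚ(√-67)ˣ)`: descent at the inert prime `3` (`-67` is a non-square mod `3`, `3 ∥ 3`); `T(3) = {3, 67}`. research route conditional on HC_CM; not a corollary; Q11.4-sentence-2 already refuted in dim ≥ 3. [cite: Serre1973, Ch. III §1] -/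
theorem not_mem_3 : Units.mk0 (3 : ℚ) (by norm_num) ∉ normUnitsSubgroup ℚ (weilField 67) := by
  simpa using natCast_not_mem_normUnitsSubgroup_of_inert (d := 67) (a := 3) (p := 3)
    (by norm_num) (by decide) (by norm_num) (by norm_num) (by norm_num)

/-- `17 ∈ Nm(ℚ(√-67)ˣ)`: `17 = 1/2² + 67·1/2²`. research route conditional on HC_CM; not a corollary; Q11.4-sentence-2 already refuted in dim ≥ 3. [cite: vanGeemen1994HodgeAV, (5.4.1)] -/
theorem mem_17 : Units.mk0 (17 : ℚ) (by norm_num) ∈ normUnitsSubgroup ℚ (weilField 67) :=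
  mem_normUnitsSubgroup_of_sq_add_mul_sq _ (1 / 2 : ℚ) (1 / 2 : ℚ) (by norm_num)

end SqrtNeg67

namespace SqrtNeg163

/-- `2 ∉ Nm(ℚ(√-163)ˣ)`: descent at the ramified prime `163` (`163 ∥ 163`, `2` is a non-square mod `163`); `T(2) = {2, 163}`. research route conditional on HC_CM; not a corollary; Q11.4-sentence-2 already refuted in dim ≥ 3. [cite: Serre1973, Ch. III §1] -/
theorem not_mem_2 : Units.mk0 (2 : ℚ) (by norm_num) ∉ normUnitsSubgroup ℚ (weilField 163) := by
  simpa using natCast_not_mem_normUnitsSubgroup_of_ramified (d := 163) (a := 2) (p := 163)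
    (by norm_num) (by norm_num) (by norm_num) (by decide +kernel) (by norm_num)

/-- `3 ∉ Nm(ℚ(√-163)ˣ)`: descent at the inert prime `3` (`-163` is a non-square mod `3`, `3 ∥ 3`); `T(3) = {3, 163}`. research route conditional on HC_CM; not a corollary; Q11.4-sentence-2 already refuted in dim ≥ 3. [cite: Serre1973, Ch. III §1] -/
theorem not_mem_3 : Units.mk0 (3 : ℚ) (by norm_num) ∉ normUnitsSubgroup ℚ (weilField 163) := by
  simpa using natCast_not_mem_normUnitsSubgroup_of_inert (d := 163) (a := 3) (p := 3)
    (by norm_num) (by decide) (by norm_num) (by norm_num) (by norm_num)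

/-- `41 ∈ Nm(ℚ(√-163)ˣ)`: `41 = 1/2² + 163·1/2²`. research route conditional on HC_CM; not a corollary; Q11.4-sentence-2 already refuted in dim ≥ 3. [cite: vanGeemen1994HodgeAV, (5.4.1)] -/
theorem mem_41 : Units.mk0 (41 : ℚ) (by norm_num) ∈ normUnitsSubgroup ℚ (weilField 163) :=
  mem_normUnitsSubgroup_of_sq_add_mul_sq _ (1 / 2 : ℚ) (1 / 2 : ℚ) (by norm_num)

end SqrtNeg163

/-! ### §8 The consumer's cell keys at `n = 3` (abelian sixfolds; pub-hsemireg TARGET-TABLE §1b row R4), fields `ℚ(√-7)`, `ℚ(√-11)`, `ℚ(√-19)`, `ℚ(√-43)`, `ℚ(√-67)`, `ℚ(√-163)` -/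

/-- Row R0 (ℚ(√-7): a = 2 ≡ 1): `[(-2 : ℚ)] = splitDiscriminantClass 3 7` — the sixfold component `(3, ℚ(√-7), δ = [-2])` IS the split one (contains the hyperbolic members). research route conditional on HC_CM; not a corollary; Q11.4-sentence-2 already refuted in dim ≥ 3. [cite: vanGeemen1994HodgeAV, (5.4.1)] -/
theorem sixfold_sqrtNeg7_neg2_eq_split :
    (QuotientGroup.mk (Units.mk0 (-2 : ℚ) (by norm_num)) : weilNormResidueGroup 7) = splitDiscriminantClass 3 7 :=
  mk_neg_eq_split_of_odd (by decide) _ SqrtNeg7.mem_2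

/-- Row R4: `[(-3 : ℚ)] ≠ splitDiscriminantClass 3 7` — the sixfold component `(3, ℚ(√-7), δ = [-3])` is NON-split (no hyperbolic / `X × X̂`-type / uniformly weighted `E_K³ × E_K³` member). research route conditional on HC_CM; not a corollary; Q11.4-sentence-2 already refuted in dim ≥ 3. [cite: vanGeemen1994HodgeAV, (5.4.1)] -/
theorem sixfold_sqrtNeg7_neg3_ne_split :
    (QuotientGroup.mk (Units.mk0 (-3 : ℚ) (by norm_num)) : weilNormResidueGroup 7) ≠ splitDiscriminantClass 3 7 :=
  mk_neg_ne_split_of_odd (by decide) _ Summit.HodgeConjecture.Ring2WeilNormDescent.three_not_mem_norm_seven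

/-- Row R4: `[(-5 : ℚ)] ≠ splitDiscriminantClass 3 7` — the sixfold component `(3, ℚ(√-7), δ = [-5])` is NON-split (no hyperbolic / `X × X̂`-type / uniformly weighted `E_K³ × E_K³` member). research route conditional on HC_CM; not a corollary; Q11.4-sentence-2 already refuted in dim ≥ 3. [cite: vanGeemen1994HodgeAV, (5.4.1)] -/
theorem sixfold_sqrtNeg7_neg5_ne_split :
    (QuotientGroup.mk (Units.mk0 (-5 : ℚ) (by norm_num)) : weilNormResidueGroup 7) ≠ splitDiscriminantClass 3 7 :=
  mk_neg_ne_split_of_odd (by decide) _ Summit.HodgeConjecture.Ring2WeilNormDescent.five_not_mem_norm_seven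

/-- Row R4: `[(-13 : ℚ)] ≠ splitDiscriminantClass 3 7` — the sixfold component `(3, ℚ(√-7), δ = [-13])` is NON-split (no hyperbolic / `X × X̂`-type / uniformly weighted `E_K³ × E_K³` member). research route conditional on HC_CM; not a corollary; Q11.4-sentence-2 already refuted in dim ≥ 3. [cite: vanGeemen1994HodgeAV, (5.4.1)] -/
theorem sixfold_sqrtNeg7_neg13_ne_split :
    (QuotientGroup.mk (Units.mk0 (-13 : ℚ) (by norm_num)) : weilNormResidueGroup 7) ≠ splitDiscriminantClass 3 7 :=
  mk_neg_ne_split_of_odd (by decide) _ Summit.HodgeConjecture.Ring2WeilNormDescent.thirteen_not_mem_norm_seven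

/-- Row R0 (ℚ(√-11): a = 3 ≡ 1): `[(-3 : ℚ)] = splitDiscriminantClass 3 11` — the sixfold component `(3, ℚ(√-11), δ = [-3])` IS the split one (contains the hyperbolic members). research route conditional on HC_CM; not a corollary; Q11.4-sentence-2 already refuted in dim ≥ 3. [cite: vanGeemen1994HodgeAV, (5.4.1)] -/
theorem sixfold_sqrtNeg11_neg3_eq_split :
    (QuotientGroup.mk (Units.mk0 (-3 : ℚ) (by norm_num)) : weilNormResidueGroup 11) = splitDiscriminantClass 3 11 :=
  mk_neg_eq_split_of_odd (by decide) _ SqrtNeg11.mem_3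

/-- Row R4: `[(-2 : ℚ)] ≠ splitDiscriminantClass 3 11` — the sixfold component `(3, ℚ(√-11), δ = [-2])` is NON-split (no hyperbolic / `X × X̂`-type / uniformly weighted `E_K³ × E_K³` member). research route conditional on HC_CM; not a corollary; Q11.4-sentence-2 already refuted in dim ≥ 3. [cite: vanGeemen1994HodgeAV, (5.4.1)] -/
theorem sixfold_sqrtNeg11_neg2_ne_split :
    (QuotientGroup.mk (Units.mk0 (-2 : ℚ) (by norm_num)) : weilNormResidueGroup 11) ≠ splitDiscriminantClass 3 11 :=
  mk_neg_ne_split_of_odd (by decide) _ Summit.HodgeConjecture.Ring2WeilNormDescent.two_not_mem_norm_eleven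

/-- Row R4: `[(-7 : ℚ)] ≠ splitDiscriminantClass 3 11` — the sixfold component `(3, ℚ(√-11), δ = [-7])` is NON-split (no hyperbolic / `X × X̂`-type / uniformly weighted `E_K³ × E_K³` member). research route conditional on HC_CM; not a corollary; Q11.4-sentence-2 already refuted in dim ≥ 3. [cite: vanGeemen1994HodgeAV, (5.4.1)] -/
theorem sixfold_sqrtNeg11_neg7_ne_split :
    (QuotientGroup.mk (Units.mk0 (-7 : ℚ) (by norm_num)) : weilNormResidueGroup 11) ≠ splitDiscriminantClass 3 11 :=
  mk_neg_ne_split_of_odd (by decide) _ Summit.HodgeConjecture.Ring2WeilNormDescent.seven_not_mem_norm_eleven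

/-- Row W6.11.14 (T = {2,7}): `[(-14 : ℚ)] ≠ splitDiscriminantClass 3 11` — the sixfold component `(3, ℚ(√-11), δ = [-14])` is NON-split (no hyperbolic / `X × X̂`-type / uniformly weighted `E_K³ × E_K³` member). research route conditional on HC_CM; not a corollary; Q11.4-sentence-2 already refuted in dim ≥ 3. [cite: vanGeemen1994HodgeAV, (5.4.1)] -/
theorem sixfold_sqrtNeg11_neg14_ne_split :
    (QuotientGroup.mk (Units.mk0 (-14 : ℚ) (by norm_num)) : weilNormResidueGroup 11) ≠ splitDiscriminantClass 3 11 :=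
  mk_neg_ne_split_of_odd (by decide) _ SqrtNeg11.not_mem_14

/-- Row R4: `[(-2 : ℚ)] ≠ splitDiscriminantClass 3 19` — the sixfold component `(3, ℚ(√-19), δ = [-2])` is NON-split (no hyperbolic / `X × X̂`-type / uniformly weighted `E_K³ × E_K³` member). research route conditional on HC_CM; not a corollary; Q11.4-sentence-2 already refuted in dim ≥ 3. [cite: vanGeemen1994HodgeAV, (5.4.1)] -/
theorem sixfold_sqrtNeg19_neg2_ne_split :
    (QuotientGroup.mk (Units.mk0 (-2 : ℚ) (by norm_num)) : weilNormResidueGroup 19) ≠ splitDiscriminantClass 3 19 :=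
  mk_neg_ne_split_of_odd (by decide) _ SqrtNeg19.not_mem_2

/-- Row R4: `[(-2 : ℚ)] ≠ splitDiscriminantClass 3 43` — the sixfold component `(3, ℚ(√-43), δ = [-2])` is NON-split (no hyperbolic / `X × X̂`-type / uniformly weighted `E_K³ × E_K³` member). research route conditional on HC_CM; not a corollary; Q11.4-sentence-2 already refuted in dim ≥ 3. [cite: vanGeemen1994HodgeAV, (5.4.1)] -/
theorem sixfold_sqrtNeg43_neg2_ne_split :
    (QuotientGroup.mk (Units.mk0 (-2 : ℚ) (by norm_num)) : weilNormResidueGroup 43) ≠ splitDiscriminantClass 3 43 :=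
  mk_neg_ne_split_of_odd (by decide) _ SqrtNeg43.not_mem_2

/-- Row R4: `[(-2 : ℚ)] ≠ splitDiscriminantClass 3 67` — the sixfold component `(3, ℚ(√-67), δ = [-2])` is NON-split (no hyperbolic / `X × X̂`-type / uniformly weighted `E_K³ × E_K³` member). research route conditional on HC_CM; not a corollary; Q11.4-sentence-2 already refuted in dim ≥ 3. [cite: vanGeemen1994HodgeAV, (5.4.1)] -/
theorem sixfold_sqrtNeg67_neg2_ne_split :
    (QuotientGroup.mk (Units.mk0 (-2 : ℚ) (by norm_num)) : weilNormResidueGroup 67) ≠ splitDiscriminantClass 3 67 :=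
  mk_neg_ne_split_of_odd (by decide) _ SqrtNeg67.not_mem_2

/-- Row R4: `[(-2 : ℚ)] ≠ splitDiscriminantClass 3 163` — the sixfold component `(3, ℚ(√-163), δ = [-2])` is NON-split (no hyperbolic / `X × X̂`-type / uniformly weighted `E_K³ × E_K³` member). research route conditional on HC_CM; not a corollary; Q11.4-sentence-2 already refuted in dim ≥ 3. [cite: vanGeemen1994HodgeAV, (5.4.1)] -/
theorem sixfold_sqrtNeg163_neg2_ne_split :
    (QuotientGroup.mk (Units.mk0 (-2 : ℚ) (by norm_num)) : weilNormResidueGroup 163) ≠ splitDiscriminantClass 3 163 :=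
  mk_neg_ne_split_of_odd (by decide) _ SqrtNeg163.not_mem_2

end Summit.HodgeConjecture.HodgeConjecture.Ring2.WeilCoverage

end
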